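import Summits.ResolutionOfSingularities.ResolutionOfSingularities.Theses.VerticalModels
import Summits.ResolutionOfSingularities.ResolutionOfSingularities.Theorems.ValuativePatchingRelBlowupResolution
import Literature.AlgebraicGeometry.Resolution.ResolutionOfComponents
import Literature.AlgebraicGeometry.Resolution.AlterationsStrong
import Literature.AlgebraicGeometry.Motives.Varieties
import HarnessLib

/-!
# Crux `PencilReduction` (stmt-ResolutionOfSingularities-16199) — birth skeleton (BC3), line `birth`

Route `ResolutionOfSingularities/VerticalModels`, crux #4 (rank 4, difficulty L, "Lean weight only"):
`PencilReduction : VerticalResolution → ResolutionOfSingularities` — the equal-characteristic MODELS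
problem (a blow-up resolution, cosupported in one closed fibre, of an integral `X → 𝔸¹_k` which is
regular off that fibre) decides the summit (every reduced separated scheme of finite type over every
field of prime characteristic has a resolution of singularities).

## The cut (two named stubs; `PencilReduction_of` proved)

The paper proof in the route header is a strong induction on the dimension `n`, run SIMULTANEOUSLY
over all fields of characteristic `p` (the induction consumes the summit's "for all fields": the
generic fibre of a pencil `X₁ → ℙ¹_K` is a variety over the imperfect field `K(t)`), in BLOW-UP FORM
(`BlowupResolutionUpToDim p n`: a regular blowing up along a non-zero ideal sheaf — the form that
spreads out from a generic fibre and composes, Stacks 080B). One induction step `dim ≤ n` is cut into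
the route's own foreseen two halves (route header, TWO-LAYER PLAN: "PencilReduction ⇐ SpreadAndExtend →
BaseLocalGluing"):

* `stub_genericFibreConfinement` — **SPREAD AND EXTEND (pencil + generic fibre + spreading; size L).**
  Given blow-up resolution in every dimension `< n` over every field of characteristic `p`, every
  integral separated finite-type `X/K` (`char K = p`) with `dim X ≤ n` admits ONE blowing up
  `ρ : X₁ = Bl_I X → X` (`I ≠ ⊥`) together with a `K`-morphism `g : X₁ → ℙ¹_K` and a finite set `S`
  of closed points of `ℙ¹_K` such that `X₁` is regular off `g⁻¹(S)` and `g` is not constant with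
  value in `S`. Paper proof: if `X` is regular (e.g. `dim X = 0`) take `I = ⊤`, `S = ∅`; else pick
  `t ∈ K(X)` transcendental over `K`, `I := 𝒟_t + t𝒟_t` (`𝒟_t` the ideal of denominators; coherent,
  non-zero), so that `X' := Bl_I X` dominates the graph closure of `t` and carries a dominant
  `g' : X' → ℙ¹_K`; the generic fibre `X'_η` is an integral separated finite-type scheme over the FIELD
  `K(t) = RatFunc K` (universe `0`, characteristic `p`) of dimension `dim X − 1 < n`; the hypothesis
  gives `Bl_{J_η} X'_η` regular with `J_η ≠ 0`; spread `J_η` over a dense open of `ℙ¹` (EGA IV₃ 8.5)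
  and extend to a coherent ideal `J̄ ≠ 0` on `X'` (EGA I 9.4.7; tree `IdealSheafExtension.lean`);
  `X₁ := Bl_{J̄} X' → X' → X` is one blowing up along a non-zero ideal (Stacks 080B, tree
  `IsBlowup.exists_isBlowup_comp`), its generic fibre over `ℙ¹` is `Bl_{J_η} X'_η` (blowing up
  commutes with the flat base change `Spec K(t) → ℙ¹`), so `X₁` is regular at every point over `η`;
  `Reg X₁` is open (finite type over a field; tree `RegularLocusOpen.lean`), hence `g(X₁ ∖ Reg X₁)` is a
  constructible subset of `ℙ¹_K` missing `η`, i.e. a finite set `S` of closed points. Why it might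
  fail: Lean weight only (generic-fibre dimension drop, spreading of an ideal sheaf and of regularity,
  blow-up vs. flat base change are not in Mathlib) — no mathematical risk.
* `stub_verticalGluing` — **BASE-LOCAL GLUING (size M–L).** Under `VerticalResolution`: given such data
  `(I, ρ, g, S)` for an integral separated finite-type `X/K`, there is a non-zero ideal sheaf `Q` on
  `X` with a regular blowing up. Paper proof: for `c ∈ S` let `U ≅ 𝔸¹_K = Spec K[T]` be a standard
  chart of `ℙ¹_K` containing `c`, `V_c := U ∖ (S ∖ {c})` (open: `S` is a finite set of closed points),
  `W_c := g⁻¹(V_c) ⊆ X₁` (open, integral), `f_c : W_c → V_c ⊆ Spec K[T]`, `q_c ∈ K[T]` the monic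
  irreducible polynomial with `V(q_c) ∩ U = {c}`; `W_c` is regular off `V(q_c ∘ f_c) = g⁻¹(c)` and the
  fibre is not all of `W_c` (`g` is dominant, or constant with value outside `S` — the clause
  `∀ c ∈ S, ∃ x, g x ≠ c` — in which case `X₁` is regular and `Q := I` works); `VerticalResolution`
  gives `Bl_{I_c} W_c` regular with `Supp I_c ⊆ g⁻¹(c)`, a closed subset of `X₁` inside `W_c`, so `I_c`
  extends by `𝒪` to an ideal `Ī_c` on `X₁`; `J := ∏_{c ∈ S} Ī_c` has `Bl_J X₁` regular (over `W_c` minus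
  the other fibres it is `Bl_{I_c} W_c`, off `g⁻¹(S)` it is `X₁`, regular by hypothesis; blow-ups exist
  and restrict to opens: tree `exists_isBlowup`, `IsBlowup.restrict`, `IsBlowup.unique`), and
  `Bl_J X₁ → X₁ → X` is a blowing up along some `Q` with `Supp Q ⊆ Supp I ∪ ρ(Supp J) ≠ X`, so `Q ≠ ⊥`
  (Stacks 080B, tree `IsBlowup.exists_isBlowup_comp`). Why it might fail: typing only (ideal-sheaf
  extension across a closed fibre, blow-up of a product of ideals with disjoint cosupports, the chart
  `U ≅ Spec K[T]` of `ℙ¹_K` and the irreducible polynomial of a closed point).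
* The assembly `PencilReduction_of : Sig.stub_genericFibreConfinement → Sig.stub_verticalGluing →
  PencilReduction` is PROVED (no `sorry` in its own term): strong induction on `n` gives
  `BlowupResolutionUpToDim p n` for all `n`; a scheme of finite type over a field has finite dimension
  (`exists_topologicalKrullDim_le_of_locallyOfFiniteType`); a regular blowing up of an integral scheme
  along a non-zero ideal is a resolution (`Theorems.hasResolution_of_isBlowup_of_isRegular`: proper by
  Stacks 02NS, birational by Stacks 02ND); reduced ⇒ integral is `resolutionInChar_iff_integral`
  (Cossart–Piltant 2019, proof of Prop. 4.6, Step 1); the summit is the conjunction over primes.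
  `PencilReduction_proof : PencilReduction` is the same with the two `stub_*` plugged in.

Disproof used: none on file for this crux (`ledger crux ls stmt-ResolutionOfSingularities-16199`: no
workfiles before this one; `ledger negatives --problem ResolutionOfSingularities` consulted 2026-08-17).
-/

noncomputable section

-- single-problem summit: the doubled namespace component `ResolutionOfSingularities` is forced
set_option linter.dupNamespace false

open CategoryTheory AlgebraicGeometry Literature.AlgebraicGeometry.Resolution
open Literature.AlgebraicGeometry.Motives (projectiveSpace)
open Summit.ResolutionOfSingularities.ResolutionOfSingularities.Theses.VerticalModels
  (VerticalResolution PencilReduction)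

namespace Summit.ResolutionOfSingularities.ResolutionOfSingularities.Cruxes.PencilReduction.Lines.Birth

/-! ## The induction predicate and the two stub STATEMENTS by name -/

/-- **Blow-up resolution in characteristic `p` up to dimension `n`, over ALL fields** (universe `0`):
every integral separated scheme of finite type `X` over a field `K` of characteristic `p` with
`dim X ≤ n` carries a non-zero ideal sheaf `I` and a blowing up `π : X' → X` along `I` with `X'`
regular. The dimension-sliced, all-fields form of the tree's `Theorems.BlowupResolutionInChar p`
(the format in which resolutions spread out from generic fibres and compose).
[cite: CossartPiltant2019, Thm. 1.1 (dimension ≤ 3, locally a blowing up)] -/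
def BlowupResolutionUpToDim (p n : ℕ) : Prop :=
  ∀ (K : Type) [Field K] [CharP K p] (X : Scheme.{0}) (f : X ⟶ Spec (.of K)),
    IsSeparated f → LocallyOfFiniteType f → QuasiCompact f → IsIntegral X →
    topologicalKrullDim X ≤ (n : WithBot ℕ∞) →
      ∃ (I : X.IdealSheafData) (X' : Scheme.{0}) (π : X' ⟶ X),
        I ≠ ⊥ ∧ IsBlowup π I ∧ Scheme.IsRegular X'

/-- Statement of `stub_genericFibreConfinement` (SPREAD AND EXTEND): blow-up resolution in all
dimensions `< n` over all fields of characteristic `p` confines the singularities of an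
`n`-dimensional integral `X/K`, after ONE blowing up `X₁ = Bl_I X` along a non-zero ideal, to finitely
many closed fibres of a `K`-morphism `g : X₁ → ℙ¹_K` which is not constant with value among them.
[cite: EGAIV3, Thm. 8.8.2 and Prop. 8.5.x (spreading out); StacksProject, Tag 080B] -/
def Sig.stub_genericFibreConfinement : Prop :=
  ∀ p : ℕ, p.Prime → ∀ n : ℕ, (∀ m : ℕ, m < n → BlowupResolutionUpToDim p m) →
    ∀ (K : Type) [Field K] [CharP K p] (X : Scheme.{0}) (f : X ⟶ Spec (.of K)),
      IsSeparated f → LocallyOfFiniteType f → QuasiCompact f → IsIntegral X →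
      topologicalKrullDim X ≤ (n : WithBot ℕ∞) →
        ∃ (I : X.IdealSheafData) (X₁ : Scheme.{0}) (ρ : X₁ ⟶ X)
          (g : X₁ ⟶ (projectiveSpace 1 K).left) (S : Set ↥(projectiveSpace 1 K).left),
          I ≠ ⊥ ∧ IsBlowup ρ I ∧ g ≫ (projectiveSpace 1 K).hom = ρ ≫ f ∧ S.Finite ∧
          (∀ c ∈ S, IsClosed ({c} : Set ↥(projectiveSpace 1 K).left)) ∧
          (∀ c ∈ S, ∃ x : X₁, g.base x ≠ c) ∧
          ∀ x : X₁, g.base x ∉ S → IsRegularLocalRing (X₁.presheaf.stalk x)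

/-- Statement of `stub_verticalGluing` (BASE-LOCAL GLUING): under `VerticalResolution`, an integral
separated finite-type `X/K` (`char K = p`) whose singularities are confined, after one blowing up
`ρ : X₁ = Bl_I X → X` (`I ≠ ⊥`), to finitely many closed fibres of a `K`-morphism `g : X₁ → ℙ¹_K` not
constant with value among them, has a regular blowing up along a non-zero ideal sheaf: apply
`VerticalResolution` over an affine line chart around each bad point, extend the fibre-cosupported
ideals by `𝒪`, blow up their product, compose with `ρ`. [cite: StacksProject, Tag 080B; Liu2002, §8.1] -/
def Sig.stub_verticalGluing : Prop :=
  VerticalResolution → ∀ p : ℕ, p.Prime →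
    ∀ (K : Type) [Field K] [CharP K p] (X : Scheme.{0}) (f : X ⟶ Spec (.of K)),
      IsSeparated f → LocallyOfFiniteType f → QuasiCompact f → IsIntegral X →
      ∀ (I : X.IdealSheafData) (X₁ : Scheme.{0}) (ρ : X₁ ⟶ X)
        (g : X₁ ⟶ (projectiveSpace 1 K).left) (S : Set ↥(projectiveSpace 1 K).left),
        I ≠ ⊥ → IsBlowup ρ I → g ≫ (projectiveSpace 1 K).hom = ρ ≫ f → S.Finite →
        (∀ c ∈ S, IsClosed ({c} : Set ↥(projectiveSpace 1 K).left)) →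
        (∀ c ∈ S, ∃ x : X₁, g.base x ≠ c) →
        (∀ x : X₁, g.base x ∉ S → IsRegularLocalRing (X₁.presheaf.stalk x)) →
          ∃ (Q : X.IdealSheafData) (X₂ : Scheme.{0}) (π : X₂ ⟶ X),
            Q ≠ ⊥ ∧ IsBlowup π Q ∧ Scheme.IsRegular X₂

/-! ## The stubs -/

/-- **STUB (SPREAD AND EXTEND; true, size L — the Lean-heaviest half).** See the module docstring:
pencil `Bl_{𝒟_t + t𝒟_t} X → ℙ¹_K`, generic fibre over `K(t)` of dimension `dim X − 1`, the
hypothesis in dimension `< n` over the field `K(t)`, spreading and extension of the blow-up ideal,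
Stacks 080B, openness of the regular locus. [cite: EGAIV3, Thm. 8.8.2; StacksProject, Tag 080B] -/
theorem stub_genericFibreConfinement :
    ∀ p : ℕ, p.Prime → ∀ n : ℕ, (∀ m : ℕ, m < n → BlowupResolutionUpToDim p m) →
    ∀ (K : Type) [Field K] [CharP K p] (X : Scheme.{0}) (f : X ⟶ Spec (.of K)),
      IsSeparated f → LocallyOfFiniteType f → QuasiCompact f → IsIntegral X →
      topologicalKrullDim X ≤ (n : WithBot ℕ∞) →
        ∃ (I : X.IdealSheafData) (X₁ : Scheme.{0}) (ρ : X₁ ⟶ X)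
          (g : X₁ ⟶ (projectiveSpace 1 K).left) (S : Set ↥(projectiveSpace 1 K).left),
          I ≠ ⊥ ∧ IsBlowup ρ I ∧ g ≫ (projectiveSpace 1 K).hom = ρ ≫ f ∧ S.Finite ∧
          (∀ c ∈ S, IsClosed ({c} : Set ↥(projectiveSpace 1 K).left)) ∧
          (∀ c ∈ S, ∃ x : X₁, g.base x ≠ c) ∧
          ∀ x : X₁, g.base x ∉ S → IsRegularLocalRing (X₁.presheaf.stalk x) := by
  sorry

/-- **STUB (BASE-LOCAL GLUING; true given `VerticalResolution`, size M–L).** See the module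
docstring: `VerticalResolution` over an affine line chart around each bad closed point, extension of
the fibre-cosupported ideals by `𝒪`, blow-up of their product, composition with `ρ` (Stacks 080B).
[cite: StacksProject, Tag 080B; Liu2002, §8.1] -/
theorem stub_verticalGluing :
    VerticalResolution → ∀ p : ℕ, p.Prime →
    ∀ (K : Type) [Field K] [CharP K p] (X : Scheme.{0}) (f : X ⟶ Spec (.of K)),
      IsSeparated f → LocallyOfFiniteType f → QuasiCompact f → IsIntegral X →
      ∀ (I : X.IdealSheafData) (X₁ : Scheme.{0}) (ρ : X₁ ⟶ X)
        (g : X₁ ⟶ (projectiveSpace 1 K).left) (S : Set ↥(projectiveSpace 1 K).left),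
        I ≠ ⊥ → IsBlowup ρ I → g ≫ (projectiveSpace 1 K).hom = ρ ≫ f → S.Finite →
        (∀ c ∈ S, IsClosed ({c} : Set ↥(projectiveSpace 1 K).left)) →
        (∀ c ∈ S, ∃ x : X₁, g.base x ≠ c) →
        (∀ x : X₁, g.base x ∉ S → IsRegularLocalRing (X₁.presheaf.stalk x)) →
          ∃ (Q : X.IdealSheafData) (X₂ : Scheme.{0}) (π : X₂ ⟶ X),
            Q ≠ ⊥ ∧ IsBlowup π Q ∧ Scheme.IsRegular X₂ := by
  sorry

/-! ## The composition (kernel-checked; no `sorry` in its own term) -/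

/-- **Blow-up resolution in every dimension from the two stub statements** (strong induction on the
dimension, all fields of characteristic `p` at once): the confinement stub consumes the induction
hypothesis in dimensions `< n` (over the function field `K(t)`), the gluing stub consumes
`VerticalResolution`. [cite: CossartPiltant2019, Cor. 1.3 (the models problem one dimension up)] -/
theorem blowupResolutionUpToDim_of (hA : Sig.stub_genericFibreConfinement)
    (hB : Sig.stub_verticalGluing) (hV : VerticalResolution) {p : ℕ} (hp : p.Prime) (n : ℕ) :
    BlowupResolutionUpToDim p n := by
  induction n using Nat.strong_induction_on with
  | h n ih =>
    intro K _ _ X f hsep hft hqc hint hdim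
    obtain ⟨I, X₁, ρ, g, S, hI, hρ, hcomm, hSfin, hScl, hdom, hreg⟩ :=
      hA p hp n ih K X f hsep hft hqc hint hdim
    exact hB hV p hp K X f hsep hft hqc hint I X₁ ρ g S hI hρ hcomm hSfin hScl hdom hreg

/-- **`PencilReduction` from the two stub statements** — the assembly, PROVED: for a prime `p`,
blow-up resolution holds in every dimension (`blowupResolutionUpToDim_of`); an integral separated
finite-type `X/K` is compact, hence of finite dimension `d`
(`exists_topologicalKrullDim_le_of_locallyOfFiniteType`), and locally Noetherian, so its regular
blowing up along a non-zero ideal sheaf is a resolution (`Theorems.hasResolution_of_isBlowup_of_isRegular`,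
Stacks 02NS + 02ND); the reduced case follows from the integral one (`resolutionInChar_iff_integral`,
Cossart–Piltant 2019, proof of Prop. 4.6, Step 1), and the summit is the conjunction over primes.
[cite: CossartPiltant2019, Prop. 4.6 (proof, Step 1)] -/
theorem PencilReduction_of :
    Sig.stub_genericFibreConfinement → Sig.stub_verticalGluing → PencilReduction := by
  intro hA hB hV
  refine _root_.ResolutionOfSingularities_iff.mpr fun p hp => ?_
  rw [resolutionInChar_iff_integral]
  intro K _ _ X f hsep hft hqc hint
  haveI : LocallyOfFiniteType f := hft
  haveI : QuasiCompact f := hqc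
  haveI : IsIntegral X := hint
  haveI : CompactSpace X := QuasiCompact.compactSpace_of_compactSpace f
  haveI : IsLocallyNoetherian X := LocallyOfFiniteType.isLocallyNoetherian f
  obtain ⟨d, hd⟩ := exists_topologicalKrullDim_le_of_locallyOfFiniteType f
  obtain ⟨I, X', π, hI, hπ, hreg⟩ :=
    blowupResolutionUpToDim_of hA hB hV hp d K X f hsep hft hqc hint hd
  exact Theorems.hasResolution_of_isBlowup_of_isRegular hI hπ hreg

/-- **The crux `PencilReduction`, assembled from the two registered stubs** (the skeleton in its
final shape: `PencilReduction_of` with the `stub_*` plugged in; the only `sorry`s in its closure are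
the two stubs, none of its own). -/
theorem PencilReduction_proof : PencilReduction :=
  PencilReduction_of stub_genericFibreConfinement stub_verticalGluing

end Summit.ResolutionOfSingularities.ResolutionOfSingularities.Cruxes.PencilReduction.Lines.Birth

end
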